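import Mathlib.LinearAlgebra.Matrix.Adjugate
import Mathlib.LinearAlgebra.Matrix.NonsingularInverse
import Mathlib.LinearAlgebra.Matrix.Block
import Mathlib.Algebra.Ring.GeomSum
import Mathlib.Data.Fin.Tuple.Basic
import Mathlib.Data.Fintype.Powerset
import Mathlib.Data.Fintype.Perm
import Mathlib.Data.Nat.Choose.Vandermonde
import Mathlib.Data.Nat.Choose.Central
import Literature.Computability.AlgebraicComplexity.PermanentVsDeterminantProofs
import HarnessLib

/-!
# Landsberg–Ressayre's equivariant determinantal representation of the permanent, I:
# the branching program on balanced pairs of subsets (LR 2017, Prop. 2.10) — paths and path sum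

Topic `Literature/Computability/AlgebraicComplexity`. First of four files
(`LandsbergRessayrePairsProgram`, `…PairsMinor`, `…PairsRelabel`, `…EquivariantUpper`) proving, in
the tree's vocabulary (`IsEquivariantDetRepr`, `permSymmetrySubst`, `EquivariantDC.lean`,
`LandsbergRessayre.lean`), the UPPER-bound half of Landsberg–Ressayre 2017, Thm. 2.1 —
`edc(perm_m) ≤ C(2m,m) - 1` — by their Prop. 2.10: "Let `ℂ^n = ⊕_{k=0}^{m-1} (S^kE)_reg ⊗ (S^kF^*)_reg`,
so `n = C(2m,m) - 1 ∼ 4^m` … `Ã = (m!)^{-1/(n-m)} Λ₀ + ∑_k S_k`. Then `(-1)^{m+1} perm_m = det_n ∘ Ã`",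
an EQUIVARIANT determinantal representation (respecting all of `𝔾_{perm_m}`). The module docstring
of `LandsbergRessayre.lean` records this half as "not vendored"; these files vendor it, with EXACT
`GL × GL` lifts.

THIS FILE: the combinatorics of the branching program, in the style of
`PermanentVsDeterminantProofs.lean` (Grenet's one-sided program on subsets) — no definitions, the
weighted adjacency matrix `A` enters through a characterising hypothesis `hA`. Vertices: balanced
pairs `(I, J)` of subsets of `α` (`|I| = |J|`; the subtype
`{P : Finset α × Finset α // P.1.card = P.2.card}`), source `(∅, ∅)`, sink `(univ, univ)`; arcs
`(I, J) → (I ∪ {i}, J ∪ {j})` (`i ∉ I`, `j ∉ J`) of weight `w i j` (later `X (i, j)`).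
* `pow_apply` — `(Aⁿ) P Q` is the sum over pairs of injective sequences of the products of weights;
* `det_one_sub` (`det (1 - A) = 1`, block-unitriangular by `|I|`), `pow_card_succ_eq_zero`,
  `adjugate_one_sub` (`adj (1 - A) = ∑_{i ≤ |α|} Aⁱ`), `adjugate_one_sub_src_snk` (the
  `(src, snk)` cofactor is the path sum);
* `sum_perm_perm_prod`, `sum_sum_ite_injective_prod_X` — with weights `X (i, j)` the path sum is
  `|α|! · PER` (each permutation arises from `|α|!` pairs of orderings);
Honest framing: a known published construction, formalised; nothing here bears on lower bounds or
on VP versus VNP.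

## References

* J. M. Landsberg, N. Ressayre, *Permanent v. determinant: an exponential lower bound assuming
  symmetry and a potential path towards Valiant's conjecture*, Differential Geom. Appl. 55 (2017)
  146–166, arXiv:1508.05788: §2.3, Prop. 2.10 (held text `paper:arxiv-1508.05788` p0006);
  Thm. 2.1 (`edc(perm_m) = C(2m,m) - 1`, `m ≥ 3`). [LandsbergRessayre2017]
* B. Grenet, *An upper bound for the permanent versus determinant problem* (2011), Thm. 1 — the
  one-sided model of the construction (tree: `PermanentVsDeterminantProofs.lean`,
  `GrenetEquivariant.lean`). [Grenet2011]
-/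

noncomputable section

open MvPolynomial Matrix Finset

namespace Literature.Computability.AlgebraicComplexity

namespace LRPairs

/-! ### Nodes: balanced pairs of subsets

The vertices of Landsberg–Ressayre's branching program are the pairs `(I, J)` of subsets of `α`
with `|I| = |J|` (a basis of `⊕_k (S^k E)_reg ⊗ (S^k F^*)_reg`, LR 2017 §2.3), i.e. the subtype
`{P : Finset α × Finset α // P.1.card = P.2.card}`; source `(∅, ∅)`, sink `(univ, univ)`. As in
`PermanentVsDeterminantProofs.lean` nothing is defined: the adjacency matrix enters through a
characterising hypothesis `hA`. -/

variable {α : Type*} [Fintype α] [DecidableEq α] {R : Type*} [CommRing R]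

omit [DecidableEq α] in
/-- Splitting a sum over `Fin (n+1) → α` along `Fin.cons`. [folklore] -/
private theorem sum_cons {n : ℕ} (G : (Fin (n + 1) → α) → R) :
    ∑ g, G g = ∑ i : α, ∑ g : Fin n → α, G (Fin.cons i g) := by
  rw [← Fintype.sum_prod_type']
  exact (Fintype.sum_equiv (Fin.consEquiv fun _ => α) (fun p => G (Fin.cons p.1 p.2)) G
    (fun _ => rfl)).symm

omit [Fintype α] in
/-- The one-sided path condition along `Fin.cons`: the sequence `(i, g)` leads injectively from
`P` to `Q` avoiding `P` iff `i ∉ P` and `g` leads from `insert i P` to `Q`. [folklore] -/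
private theorem cons_cond_iff [Fintype α] (P Q : Finset α) {n : ℕ} (i : α) (g : Fin n → α) :
    (Function.Injective (Fin.cons i g : Fin (n + 1) → α) ∧
        (∀ t, (Fin.cons i g : Fin (n + 1) → α) t ∉ P) ∧
          P ∪ univ.image (Fin.cons i g : Fin (n + 1) → α) = Q) ↔
      (i ∉ P ∧ (Function.Injective g ∧ (∀ t, g t ∉ insert i P) ∧ insert i P ∪ univ.image g = Q)) := by
  have hcons_image : univ.image (Fin.cons i g : Fin (n + 1) → α) = insert i (univ.image g) := by
    ext a
    simp [Fin.exists_fin_succ, eq_comm]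
  simp only [Fin.cons_injective_iff, Fin.forall_fin_succ, Fin.cons_zero, Fin.cons_succ,
    hcons_image, Set.mem_range, not_exists, mem_insert, not_or, forall_and, union_insert,
    insert_union]
  tauto

/-! ### Paths in the pairs program -/

/-- **Paths in the pairs branching program.** Let `A` be the weighted adjacency matrix on the
balanced pairs: an arc `(I, J) → (insert i I, insert j J)` of weight `w i j` for `i ∉ I`, `j ∉ J`.
Then `(Aⁿ) P Q` is the sum over the pairs `(g, h)` of injective sequences `Fin n → α`, `g`
avoiding `P.1` with `P.1 ∪ im g = Q.1` and `h` avoiding `P.2` with `P.2 ∪ im h = Q.2`, of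
`∏ₜ w (g t) (h t)`. [cite: LandsbergRessayre2017, Prop. 2.10] -/
theorem pow_apply (w : α → α → R) {A : Matrix {P : Finset α × Finset α // P.1.card = P.2.card}
      {P : Finset α × Finset α // P.1.card = P.2.card} R}
    (hA : ∀ P Q, A P Q = ∑ i, ∑ j,
      if i ∉ P.1.1 ∧ j ∉ P.1.2 ∧ Q.1 = (insert i P.1.1, insert j P.1.2) then w i j else 0)
    (n : ℕ) (P Q : {P : Finset α × Finset α // P.1.card = P.2.card}) :
    (A ^ n) P Q = ∑ g : Fin n → α, ∑ h : Fin n → α,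
      if (Function.Injective g ∧ (∀ t, g t ∉ P.1.1) ∧ P.1.1 ∪ univ.image g = Q.1.1) ∧
          (Function.Injective h ∧ (∀ t, h t ∉ P.1.2) ∧ P.1.2 ∪ univ.image h = Q.1.2)
      then ∏ t, w (g t) (h t) else 0 := by
  induction n generalizing P with
  | zero =>
    have : (P.1.1 = Q.1.1 ∧ P.1.2 = Q.1.2) ↔ P = Q := by
      rw [Subtype.ext_iff, Prod.ext_iff]
    simp [Matrix.one_apply, Function.injective_of_subsingleton, this]
  | succ n ih =>
    rw [pow_succ', Matrix.mul_apply]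
    calc ∑ U, A P U * (A ^ n) U Q
        = ∑ U, ∑ i, ∑ j, (if i ∉ P.1.1 ∧ j ∉ P.1.2 ∧ U.1 = (insert i P.1.1, insert j P.1.2)
            then w i j * (A ^ n) U Q else 0) := by
          refine sum_congr rfl fun U _ => ?_
          rw [hA, sum_mul]
          refine sum_congr rfl fun i _ => ?_
          rw [sum_mul]
          refine sum_congr rfl fun j _ => ?_
          split_ifs <;> simp
      _ = ∑ i, ∑ j, ∑ U : {P : Finset α × Finset α // P.1.card = P.2.card}, (if i ∉ P.1.1 ∧ j ∉ P.1.2 ∧ U.1 = (insert i P.1.1, insert j P.1.2)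
            then w i j * (A ^ n) U Q else 0) := by
          rw [sum_comm]
          exact sum_congr rfl fun i _ => sum_comm
      _ = ∑ i, ∑ j, (if i ∉ P.1.1 ∧ j ∉ P.1.2 then
            w i j * ∑ g : Fin n → α, ∑ h : Fin n → α,
              (if (Function.Injective g ∧ (∀ t, g t ∉ insert i P.1.1) ∧
                    insert i P.1.1 ∪ univ.image g = Q.1.1) ∧
                  (Function.Injective h ∧ (∀ t, h t ∉ insert j P.1.2) ∧
                    insert j P.1.2 ∪ univ.image h = Q.1.2)
                then ∏ t, w (g t) (h t) else 0) else 0) := by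
          refine sum_congr rfl fun i _ => sum_congr rfl fun j _ => ?_
          by_cases hij : i ∉ P.1.1 ∧ j ∉ P.1.2
          · rw [if_pos hij]
            have hbal : (insert i P.1.1, insert j P.1.2).1.card = (insert i P.1.1, insert j P.1.2).2.card := by
              simp only [card_insert_of_notMem hij.1, card_insert_of_notMem hij.2, P.2]
            rw [Finset.sum_eq_single_of_mem (⟨(insert i P.1.1, insert j P.1.2), hbal⟩ : {P : Finset α × Finset α // P.1.card = P.2.card})
              (mem_univ _) (fun U _ hU => if_neg fun h => hU (Subtype.ext h.2.2)),
              if_pos ⟨hij.1, hij.2, rfl⟩, ih]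
          · rw [if_neg hij]
            exact sum_eq_zero fun U _ => if_neg fun h => hij ⟨h.1, h.2.1⟩
      _ = ∑ i, ∑ j, ∑ g : Fin n → α, ∑ h : Fin n → α,
            (if (i ∉ P.1.1 ∧ (Function.Injective g ∧ (∀ t, g t ∉ insert i P.1.1) ∧
                    insert i P.1.1 ∪ univ.image g = Q.1.1)) ∧
                (j ∉ P.1.2 ∧ (Function.Injective h ∧ (∀ t, h t ∉ insert j P.1.2) ∧
                    insert j P.1.2 ∪ univ.image h = Q.1.2))
              then w i j * ∏ t, w (g t) (h t) else 0) := by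
          refine sum_congr rfl fun i _ => sum_congr rfl fun j _ => ?_
          by_cases hij : i ∉ P.1.1 ∧ j ∉ P.1.2
          · rw [if_pos hij, mul_sum]
            refine sum_congr rfl fun g _ => ?_
            rw [mul_sum]
            refine sum_congr rfl fun h _ => ?_
            by_cases hc : (Function.Injective g ∧ (∀ t, g t ∉ insert i P.1.1) ∧
                    insert i P.1.1 ∪ univ.image g = Q.1.1) ∧
                  (Function.Injective h ∧ (∀ t, h t ∉ insert j P.1.2) ∧
                    insert j P.1.2 ∪ univ.image h = Q.1.2)
            · rw [if_pos hc, if_pos ⟨⟨hij.1, hc.1⟩, ⟨hij.2, hc.2⟩⟩]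
            · rw [if_neg hc, mul_zero, if_neg fun H => hc ⟨H.1.2, H.2.2⟩]
          · rw [if_neg hij]
            symm
            refine sum_eq_zero fun g _ => sum_eq_zero fun h _ => if_neg fun H => hij ⟨H.1.1, H.2.1⟩
      _ = ∑ i, ∑ g : Fin n → α, ∑ j, ∑ h : Fin n → α,
            (if (i ∉ P.1.1 ∧ (Function.Injective g ∧ (∀ t, g t ∉ insert i P.1.1) ∧
                    insert i P.1.1 ∪ univ.image g = Q.1.1)) ∧
                (j ∉ P.1.2 ∧ (Function.Injective h ∧ (∀ t, h t ∉ insert j P.1.2) ∧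
                    insert j P.1.2 ∪ univ.image h = Q.1.2))
              then w i j * ∏ t, w (g t) (h t) else 0) := by
          exact sum_congr rfl fun i _ => sum_comm
      _ = _ := by
          rw [sum_cons]
          refine sum_congr rfl fun i _ => sum_congr rfl fun g _ => ?_
          rw [sum_cons]
          refine sum_congr rfl fun j _ => sum_congr rfl fun h _ => ?_
          have hiff := and_congr (cons_cond_iff P.1.1 Q.1.1 i g) (cons_cond_iff P.1.2 Q.1.2 j h)
          by_cases hc : (i ∉ P.1.1 ∧ (Function.Injective g ∧ (∀ t, g t ∉ insert i P.1.1) ∧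
                    insert i P.1.1 ∪ univ.image g = Q.1.1)) ∧
                (j ∉ P.1.2 ∧ (Function.Injective h ∧ (∀ t, h t ∉ insert j P.1.2) ∧
                    insert j P.1.2 ∪ univ.image h = Q.1.2))
          · rw [if_pos hc, if_pos (hiff.mpr hc), Fin.prod_univ_succ, Fin.cons_zero, Fin.cons_zero]
            simp only [Fin.cons_succ]
          · rw [if_neg hc, if_neg fun H => hc (hiff.mp H)]


/-! ### Nilpotency, the adjugate and the path sum -/

/-- An arc raises the common cardinality by one, so `1 - A` is block upper-unitriangular for the
grading `(I, J) ↦ |I|` and `det (1 - A) = 1`. [folklore] -/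
private theorem det_one_sub (w : α → α → R) {A : Matrix {P : Finset α × Finset α // P.1.card = P.2.card}
      {P : Finset α × Finset α // P.1.card = P.2.card} R}
    (hA : ∀ P Q, A P Q = ∑ i, ∑ j,
      if i ∉ P.1.1 ∧ j ∉ P.1.2 ∧ Q.1 = (insert i P.1.1, insert j P.1.2) then w i j else 0) :
    (1 - A).det = 1 := by
  have hAPQ : ∀ P Q : {P : Finset α × Finset α // P.1.card = P.2.card}, Q.1.1.card ≤ P.1.1.card → A P Q = 0 := by
    intro P Q hle
    rw [hA]
    refine sum_eq_zero fun i _ => sum_eq_zero fun j _ => if_neg ?_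
    rintro ⟨hi, -, hQ⟩
    have : Q.1.1 = insert i P.1.1 := by rw [hQ]
    rw [this, card_insert_of_notMem hi] at hle
    omega
  have hT : (1 - A).BlockTriangular fun P : {P : Finset α × Finset α // P.1.card = P.2.card} => P.1.1.card := by
    intro P Q hlt
    have hne : P ≠ Q := by
      rintro rfl
      exact lt_irrefl _ hlt
    rw [Matrix.sub_apply, Matrix.one_apply_ne hne, hAPQ P Q hlt.le, sub_zero]
  rw [hT.det]
  refine prod_eq_one fun c _ => ?_
  rw [show (1 - A).toSquareBlock
    (fun P : {P : Finset α × Finset α // P.1.card = P.2.card} => P.1.1.card) c = 1 from ?_, Matrix.det_one]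
  ext ⟨P, hP⟩ ⟨Q, hQ⟩
  rw [Matrix.toSquareBlock_def, Matrix.of_apply, Matrix.sub_apply, hAPQ P Q (by rw [hP, hQ]),
    sub_zero, Matrix.one_apply, Matrix.one_apply]
  simp only [Subtype.mk.injEq]

/-- All paths have length `≤ |α|`: `A ^ (|α| + 1) = 0`. [folklore] -/
private theorem pow_card_succ_eq_zero (w : α → α → R) {A : Matrix {P : Finset α × Finset α // P.1.card = P.2.card}
      {P : Finset α × Finset α // P.1.card = P.2.card} R}
    (hA : ∀ P Q, A P Q = ∑ i, ∑ j,
      if i ∉ P.1.1 ∧ j ∉ P.1.2 ∧ Q.1 = (insert i P.1.1, insert j P.1.2) then w i j else 0) :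
    A ^ (Fintype.card α + 1) = 0 := by
  ext P Q
  rw [pow_apply w hA, Matrix.zero_apply]
  refine sum_eq_zero fun g _ => sum_eq_zero fun h _ => if_neg ?_
  rintro ⟨⟨hg, -, -⟩, -⟩
  simpa using Fintype.card_le_of_injective g hg

/-- The adjugate of the unipotent `1 - A` is the finite geometric series `∑_{i ≤ |α|} Aⁱ`.
[folklore] -/
private theorem adjugate_one_sub (w : α → α → R) {A : Matrix {P : Finset α × Finset α // P.1.card = P.2.card}
      {P : Finset α × Finset α // P.1.card = P.2.card} R}
    (hA : ∀ P Q, A P Q = ∑ i, ∑ j,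
      if i ∉ P.1.1 ∧ j ∉ P.1.2 ∧ Q.1 = (insert i P.1.1, insert j P.1.2) then w i j else 0) :
    (1 - A).adjugate = ∑ i ∈ range (Fintype.card α + 1), A ^ i := by
  have hmul : (1 - A) * ∑ i ∈ range (Fintype.card α + 1), A ^ i = 1 := by
    rw [mul_neg_geom_sum, pow_card_succ_eq_zero w hA, sub_zero]
  have hinv := Matrix.inv_eq_right_inv hmul
  rwa [Matrix.inv_def, det_one_sub w hA, Ring.inverse_one, one_smul] at hinv

/-- **The path sum of the pairs program**: the `((∅, ∅), (univ, univ))` entry of `adjugate (1 - A)` is the sum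
over the pairs `(g, h)` of injective (equivalently bijective) maps `Fin |α| → α` of
`∏ₜ w (g t) (h t)`. [cite: LandsbergRessayre2017, Prop. 2.10] -/
theorem adjugate_one_sub_src_snk (w : α → α → R) {A : Matrix {P : Finset α × Finset α // P.1.card = P.2.card}
      {P : Finset α × Finset α // P.1.card = P.2.card} R}
    (hA : ∀ P Q, A P Q = ∑ i, ∑ j,
      if i ∉ P.1.1 ∧ j ∉ P.1.2 ∧ Q.1 = (insert i P.1.1, insert j P.1.2) then w i j else 0) :
    (1 - A).adjugate ⟨(∅, ∅), rfl⟩ ⟨(univ, univ), rfl⟩ =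
      ∑ g : Fin (Fintype.card α) → α, ∑ h : Fin (Fintype.card α) → α,
        if Function.Injective g ∧ Function.Injective h then ∏ t, w (g t) (h t) else 0 := by
  have himg : ∀ {n : ℕ} (g : Fin n → α), Function.Injective g →
      (univ.image g = univ ↔ n = Fintype.card α) := by
    intro n g hg
    constructor
    · intro h
      have hc := card_image_of_injective univ hg
      rw [h, card_univ, card_univ, Fintype.card_fin] at hc
      exact hc.symm
    · intro h
      apply eq_univ_of_card
      rw [card_image_of_injective univ hg, card_univ, Fintype.card_fin, h]
  rw [adjugate_one_sub w hA, Matrix.sum_apply,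
    sum_eq_single_of_mem (Fintype.card α) (by simp) ?_]
  · rw [pow_apply w hA]
    refine sum_congr rfl fun g _ => sum_congr rfl fun h _ => ?_
    simp only [Finset.notMem_empty, not_false_eq_true, implies_true, true_and,
      empty_union]
    by_cases hg : Function.Injective g
    · by_cases hh : Function.Injective h
      · simp [hg, hh, (himg g hg).2 rfl, (himg h hh).2 rfl]
      · simp [hh]
    · simp [hg]
  · intro i _ hi
    rw [pow_apply w hA]
    refine sum_eq_zero fun g _ => sum_eq_zero fun h _ => if_neg ?_
    rintro ⟨⟨hg, -, hT⟩, -⟩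
    simp only [empty_union] at hT
    exact hi ((himg g hg).1 hT)

/-- **Double sum over permutations.** `∑_{σ, τ} ∏ₜ M (σ t) (τ t) = |α|! · ∑_ρ ∏ₛ M (ρ s) s`:
for fixed `τ` reindex the product by `s = τ t` and the sum by `ρ = σ τ⁻¹`. [folklore] -/
private theorem sum_perm_perm_prod (M : α → α → R) :
    ∑ σ : Equiv.Perm α, ∑ τ : Equiv.Perm α, ∏ t, M (σ t) (τ t) =
      (Fintype.card α).factorial • ∑ ρ : Equiv.Perm α, ∏ s, M (ρ s) s := by
  classical
  have key : ∀ τ : Equiv.Perm α,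
      ∑ σ : Equiv.Perm α, ∏ t, M (σ t) (τ t) = ∑ ρ : Equiv.Perm α, ∏ s, M (ρ s) s := by
    intro τ
    have hprod : ∀ σ : Equiv.Perm α, ∏ t, M (σ t) (τ t) = ∏ s, M ((σ * τ⁻¹) s) s := by
      intro σ
      rw [← Equiv.prod_comp τ (fun s => M ((σ * τ⁻¹) s) s)]
      refine prod_congr rfl fun t _ => ?_
      simp [Equiv.Perm.mul_apply]
    simp_rw [hprod]
    exact Fintype.sum_equiv (Equiv.mulRight τ⁻¹) _ _ fun σ => rfl
  rw [sum_comm]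
  simp_rw [key]
  rw [sum_const, card_univ, Fintype.card_perm]

omit [DecidableEq α] in
/-- The path sum with the pure variable weights `w i j = X (i, j)` is `|α|! · PER`
(`∑_{g, h injective} ∏ₜ X (g t, h t) = ∑_{σ, τ} ∏ₜ X (σ t, τ t)`, and Mathlib's
`permanent M = ∑_σ ∏ᵢ M (σ i) i`). [cite: LandsbergRessayre2017, Prop. 2.10] -/
theorem sum_sum_ite_injective_prod_X [DecidableEq α] :
    (∑ g : Fin (Fintype.card α) → α, ∑ h : Fin (Fintype.card α) → α,
        if Function.Injective g ∧ Function.Injective h then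
          ∏ t, (X (g t, h t) : MvPolynomial (α × α) R) else 0) =
      (Fintype.card α).factorial • perPoly α R := by
  classical
  -- pass to `Fin |α| ≃ α`-free form: reindex maps `Fin |α| → α` along an equivalence
  obtain ⟨e⟩ : Nonempty (Fin (Fintype.card α) ≃ α) := ⟨(Fintype.equivFin α).symm⟩
  have step1 : (∑ g : Fin (Fintype.card α) → α, ∑ h : Fin (Fintype.card α) → α,
        if Function.Injective g ∧ Function.Injective h then
          ∏ t, (X (g t, h t) : MvPolynomial (α × α) R) else 0) =
      ∑ g : α → α, ∑ h : α → α,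
        if Function.Injective g ∧ Function.Injective h then
          ∏ s, (X (g s, h s) : MvPolynomial (α × α) R) else 0 := by
    apply Fintype.sum_equiv (e.arrowCongr (Equiv.refl α))
    intro g
    apply Fintype.sum_equiv (e.arrowCongr (Equiv.refl α))
    intro h
    have harr : ∀ f : Fin (Fintype.card α) → α, (e.arrowCongr (Equiv.refl α)) f = f ∘ e.symm :=
      fun _ => rfl
    have hg : Function.Injective ((e.arrowCongr (Equiv.refl α)) g) ↔ Function.Injective g := by
      rw [harr]
      exact Function.Injective.of_comp_iff' g e.symm.bijective
    have hh : Function.Injective ((e.arrowCongr (Equiv.refl α)) h) ↔ Function.Injective h := by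
      rw [harr]
      exact Function.Injective.of_comp_iff' h e.symm.bijective
    by_cases hc : Function.Injective g ∧ Function.Injective h
    · rw [if_pos hc, if_pos ⟨hg.2 hc.1, hh.2 hc.2⟩,
        ← Equiv.prod_comp e.symm (fun t => (X (g t, h t) : MvPolynomial (α × α) R))]
      rfl
    · rw [if_neg hc, if_neg fun H => hc ⟨hg.1 H.1, hh.1 H.2⟩]
  rw [step1]
  have step2 : (∑ g : α → α, ∑ h : α → α,
        if Function.Injective g ∧ Function.Injective h then
          ∏ s, (X (g s, h s) : MvPolynomial (α × α) R) else 0) =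
      ∑ g : α → α, (if Function.Injective g then
        ∑ h : α → α, (if Function.Injective h then
          ∏ s, (X (g s, h s) : MvPolynomial (α × α) R) else 0) else 0) := by
    refine sum_congr rfl fun g _ => ?_
    by_cases hg : Function.Injective g
    · rw [if_pos hg]
      refine sum_congr rfl fun h _ => ?_
      by_cases hh : Function.Injective h
      · rw [if_pos ⟨hg, hh⟩, if_pos hh]
      · rw [if_neg hh, if_neg fun H => hh H.2]
    · rw [if_neg hg]
      exact sum_eq_zero fun h _ => if_neg fun H => hg H.1
  rw [step2, Grenet.sum_ite_injective]
  simp_rw [Grenet.sum_ite_injective]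
  rw [show (∑ σ : Equiv.Perm α, ∑ τ : Equiv.Perm α, ∏ s, (X (σ s, τ s) : MvPolynomial (α × α) R)) =
      (Fintype.card α).factorial • ∑ ρ : Equiv.Perm α, ∏ s, (X (ρ s, s) : MvPolynomial (α × α) R)
    from sum_perm_perm_prod (R := MvPolynomial (α × α) R) (fun i j => X (i, j)), perPoly,
    Matrix.permanent]
  rfl

end LRPairs

end Literature.Computability.AlgebraicComplexity
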